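import Summits.HodgeConjecture.CorCM.StabiliserOrbitDoubleFlipReflexSlot
import Summits.HodgeConjecture.CorCM.PairFlipCMFieldTimesReflexFieldHodge
import HarnessLib

/-!
# A DOUBLE-FLIP CM field against its REFLEX field when all conjugate types lie at even Hamming distance: the incidence
# criterion — octic fields with Galois group `W(D₄)` against their OCTIC reflex fields

COR-CM (cell `pub-hodgecm2`, binder seat `b16` gen 53, count-neutral claim ORBIT-CRITERION, file F9 — CM fields and abelian
varieties; theorems only, no definition, no named fact, no `sorry`).  NEW as stated, hence under `Summits/`.  HONEST
FRAMING: unconditional statements about pairs of CM types and products of CM abelian varieties; `HC_CM` is neither used nor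
asserted.

Number-field dress of F8 (`StabiliserOrbitDoubleFlipReflexSlot`).  `K_{i₀}` a CM field of degree `2n ≥ 6` with DOUBLE FLIPS
(gen 46: even sign kernel) whose type `Φ₀` lies at EVEN Hamming distance from all its conjugates
(`(EV)`: `#{x ∈ Φ₀ : τx ∉ Φ₀}` even for every `τ ∈ Aut(ℂ)` — automatic when the sign image of `Gal` IS the even kernel, e.g.
octic fields with Galois group `W(D₄)` of order 192 or its transitive subgroups of order 96 containing the even kernel); then
the orbit of `Φ₀` has `2ⁿ⁻¹·[…]` types and the reflex field `ψ₀(K_{i₁}) = K₀*` has HALF the generic degree — for a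
`W(D₄)`-octic, `[K₀* : ℚ] = 8`: the TRIALITY TWIN (its stabiliser `𝔖₄` is not conjugate to the point stabiliser
`(ℤ₂)² ⋊ 𝔖₃`; different maximal real subfields, so NOT a companion in the sense of gen 51).  `ψ₀` a reflex embedding
(`Fix ψ₀ = Stab Φ₀`, or `ψ₀(K_{i₁}) = traceField Φ₀`), incidence numbers `N(x) = #{y ∈ Φ₁ : ∃ σ, σψ₀ = y ∧ σ⁻¹x ∈ Φ₀}`.

* §1 `even_card_typeMap_diff_of_even_conj` — (EV) on `Φ₀` gives F8's hypothesis on the reflex slot;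
  **`isNondegenerateFamily_iff_of_doubleFlip_of_reflexEmbedding`**, **`cmFamilyRank_add_card_eq_iff_of_doubleFlip_of_reflexEmbedding`**,
  `…_of_range_eq_traceField`: the pair `(Φ₀, Φ₁)` is nondegenerate (resp. `Hg(A₀ × A₁) = Hg(A₀) × Hg(A₁)`) IFF `Φ₁` is
  nondegenerate and (resp. iff) `N` is NOT `a` on `Φ₀`, `b` off `Φ₀` with `a ≠ b`.
* §2 varieties: **`hodgeConjectureFor_prod_of_doubleFlip_of_reflexEmbedding`**, **`forall_prod_hodgeClassSpan_eq_iff_of_doubleFlip_of_reflexEmbedding`**.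
NUMERICS (brute force on the 8-point even cube, local < 1 s; NOT a kernel statement): for `n = 4` NONE of the 16 partner
types of the octic reflex slot has constant unequal incidence (`Σ_{x∈Φ₀} N(x) = 2(a+b) − 2 + 4·[Φ₀ ∈ Φ₁]` with `a + b = 4`
forces `b − a` odd AND `a + b` even — impossible), so the kernel criterion predicts: a `W(D₄)`-octic CM fourfold against ANY
CM fourfold of its reflex octic is ADDITIVE, the pair being nondegenerate iff `Φ₁` is — the divisibility step is left to a
sequel (it needs `#Hom(K_{i₁}, ℂ) = 8` and the distance-`2` structure of the even cube).

## References

* [Dodson1984] B. Dodson, *The structure of Galois groups of CM-fields*, Trans. AMS 283 (1984), §1 (Reflex Degree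
  Theorem), §1.1, §5.1, §5.2 (`n = 4`: the groups of order 192, 96 and their reflex degrees).
* [Shimura1998] G. Shimura, *Abelian Varieties with Complex Multiplication and Modular Functions*, §8.3 Prop. 28.
* [Gordon1999HodgeAVSurvey] B. B. Gordon, *A survey of the Hodge conjecture for abelian varieties*, §3 Theorem, 7.5–7.7,
  9.4.3, 10.10.
-/

set_option autoImplicit false

noncomputable section

open scoped BigOperators

universe u

namespace Summit.HodgeConjecture.CorCM

namespace ReflexSlot

open Literature.NumberTheory.ComplexMultiplication
open scoped Classical

variable {G : Type u} [Group G] {Z Y : Type*} [MulAction G Z] [MulAction G Y] [Fintype Z] {Φ₀ : Set Z}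
  {T : Y → Set Z} {y₀ : Y}

/-- **(EV) on the base type gives even difference sets on the reflex slot**: if `#{z ∈ Φ₀ : τz ∉ Φ₀}` is even for every
`τ ∈ G`, then `#(T y ∖ T y')` is even for all `y, y'` (`T(g y₀) ∖ T(g' y₀) = g·{z ∈ Φ₀ : g'⁻¹g z ∉ Φ₀}`).
[cite: Dodson1984, §1.1] -/
theorem even_card_typeMap_diff_of_even_conj
    (hT : ∀ (g : G) (y : Y) (x : Z), x ∈ T (g • y) ↔ g⁻¹ • x ∈ T y) (hT₀ : T y₀ = Φ₀)
    (hY : ∀ y : Y, ∃ g : G, g • y₀ = y)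
    (heven : ∀ τ : G, Even (Finset.univ.filter fun z : Z => z ∈ Φ₀ ∧ τ • z ∉ Φ₀).card) (y y' : Y) :
    Even (Finset.univ.filter fun x : Z => x ∈ T y ∧ x ∉ T y').card := by
  obtain ⟨g, rfl⟩ := hY y
  obtain ⟨g', rfl⟩ := hY y'
  have hc : (Finset.univ.filter fun x : Z => x ∈ T (g • y₀) ∧ x ∉ T (g' • y₀)).card =
      (Finset.univ.filter fun z : Z => z ∈ Φ₀ ∧ (g'⁻¹ * g) • z ∉ Φ₀).card := by
    refine Finset.card_equiv (MulAction.toPerm g⁻¹) fun x => ?_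
    simp only [Finset.mem_filter, Finset.mem_univ, true_and, MulAction.toPerm_apply]
    rw [mem_typeMap_smul_base_iff hT hT₀, mem_typeMap_smul_base_iff hT hT₀, mul_smul, smul_inv_smul]
  rw [hc]
  exact heven _

end ReflexSlot

/-! ### §1 CM fields: a double-flip field against its half-degree reflex field -/

open CategoryTheory CategoryTheory.Limits NumberField Module
open Literature.NumberTheory.ComplexMultiplication
open Literature.AlgebraicGeometry.Motives (AbelianVariety CMType)
open Literature.AlgebraicGeometry.HodgeTheory
open Literature.AlgebraicGeometry.ComplexMultiplication (IsCMTypeRealisation)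
open Literature.AlgebraicGeometry.VanGeemen1994 (hodgeClassSpan)
open Literature.AlgebraicGeometry.Pohlmann1968
open Literature.Barriers.HodgeConjecture (divisorClassesSpan)
open scoped Classical

variable {I : Type} {K : I → Type} [∀ i, Field (K i)] [∀ i, NumberField (K i)] [∀ i, IsCMField (K i)] [Fintype I]
  [DecidableEq I] {Φ : ∀ i, CMType (K i)} {i₀ i₁ : I}

omit [∀ i, IsCMField (K i)] [DecidableEq I] in
/-- `|⊔_i Hom(K_i, ℂ)| = Σ_i [K_i : ℚ]`. [folklore] -/
private theorem card_sigma_ringHom_eq_sum₅₃r : Fintype.card ((i : I) × (K i →+* ℂ)) = ∑ i, finrank ℚ (K i) := by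
  rw [Fintype.card_sigma]
  exact Finset.sum_congr rfl fun i _ => Embeddings.card (K i) ℂ

section Types

/-- **DOUBLE-FLIP FIELD × ITS (HALF-DEGREE) REFLEX FIELD (nondegeneracy form).**  `I = {i₀, i₁}`, `[K_{i₀} : ℚ] ≥ 6`, double
flips, (EV) for `Φ₀`, `ψ₀` a reflex embedding of `K_{i₁}` for `Φ₀`: the pair `(Φ₀, Φ₁)` is nondegenerate IFF `Φ₁` is
nondegenerate AND the incidence numbers `N(x) = #{y ∈ Φ₁ : ∃ σ, σψ₀ = y ∧ σ⁻¹x ∈ Φ₀}` are NOT `a` on `Φ₀`, `b` off `Φ₀`,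
`a ≠ b`. [cite: Gordon1999HodgeAVSurvey, 7.5–7.7 and 9.4.3] [cite: Dodson1984, §1.1, §5.1 and §5.2] [cite: Shimura1998, §8.3 Prop. 28] -/
theorem isNondegenerateFamily_iff_of_doubleFlip_of_reflexEmbedding (hI : ∀ i, i = i₀ ∨ i = i₁) (h01 : i₀ ≠ i₁)
    (h6 : 6 ≤ finrank ℚ (K i₀))
    (hflip : ∀ s t : K i₀ →+* ℂ, t ≠ s → t ≠ (starRingAut : ℂ ≃+* ℂ) • s → ∃ σ : ℂ ≃+* ℂ,
      σ • s = (starRingAut : ℂ ≃+* ℂ) • s ∧ σ • t = (starRingAut : ℂ ≃+* ℂ) • t ∧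
      ∀ u : K i₀ →+* ℂ, u ≠ s → u ≠ (starRingAut : ℂ ≃+* ℂ) • s → u ≠ t → u ≠ (starRingAut : ℂ ≃+* ℂ) • t →
        σ • u = u)
    (heven : ∀ τ : ℂ ≃+* ℂ,
      Even (Finset.univ.filter fun x : K i₀ →+* ℂ => x ∈ (Φ i₀).1 ∧ τ • x ∉ (Φ i₀).1).card)
    {ψ₀ : K i₁ →+* ℂ}
    (hψ₀ : ∀ σ : ℂ ≃+* ℂ, σ • ψ₀ = ψ₀ ↔ ∀ x : K i₀ →+* ℂ, σ • x ∈ (Φ i₀).1 ↔ x ∈ (Φ i₀).1) :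
    CMAlgebra.IsNondegenerateFamily Φ ↔ IsNondegenerate (Φ i₁) ∧
      ¬ ∃ a b : ℕ, a ≠ b ∧ ∀ x : K i₀ →+* ℂ,
        (Finset.univ.filter fun y : K i₁ →+* ℂ =>
          y ∈ (Φ i₁).1 ∧ ∃ σ : ℂ ≃+* ℂ, σ • ψ₀ = y ∧ σ⁻¹ • x ∈ (Φ i₀).1).card =
          if x ∈ (Φ i₀).1 then a else b := by
  haveI := isPretransitive_ringEquiv_complex (K := K i₀)
  haveI : Nonempty I := ⟨i₀⟩
  obtain ⟨T, hT, hTi, hT₀, hY, hmem⟩ := exists_typeMap_of_reflexEmbedding (Φ i₀) hψ₀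
  have h6' : 6 ≤ Fintype.card (K i₀ →+* ℂ) := by rw [Embeddings.card]; exact h6
  have key := ReflexSlot.typeRank_sigmaType_eq_iff_of_doubleFlip_of_typeMap (G := ℂ ≃+* ℂ) (Φ := fun i => (Φ i).1)
    (fun i => isCMTypeWith_conj (Φ i)) hI h01 h6' hflip hT hTi hT₀ hY
    (ReflexSlot.even_card_typeMap_diff_of_even_conj hT hT₀ hY heven)
  rw [CMAlgebra.isNondegenerateFamily_iff, ← card_sigma_ringHom_eq_sum₅₃r (K := K), isNondegenerate_iff, cmTypeRank,
    ← Embeddings.card (K i₁) ℂ]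
  refine key.trans ?_
  simp only [hmem]

/-- **DOUBLE-FLIP FIELD × ITS REFLEX FIELD (rank form)**: `rank(Φ₀, Φ₁) + 2 = rank Φ₀ + rank Φ₁ + 1`
(`Hg(A₀ × A₁) = Hg(A₀) × Hg(A₁)`) IFF the incidence numbers are not constant-unequal on / off `Φ₀`.
[cite: Gordon1999HodgeAVSurvey, §3 Theorem (1), 7.5–7.7 and 9.4.3] [cite: Dodson1984, §5.1 and §5.2] -/
theorem cmFamilyRank_add_card_eq_iff_of_doubleFlip_of_reflexEmbedding (hI : ∀ i, i = i₀ ∨ i = i₁) (h01 : i₀ ≠ i₁)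
    (h6 : 6 ≤ finrank ℚ (K i₀))
    (hflip : ∀ s t : K i₀ →+* ℂ, t ≠ s → t ≠ (starRingAut : ℂ ≃+* ℂ) • s → ∃ σ : ℂ ≃+* ℂ,
      σ • s = (starRingAut : ℂ ≃+* ℂ) • s ∧ σ • t = (starRingAut : ℂ ≃+* ℂ) • t ∧
      ∀ u : K i₀ →+* ℂ, u ≠ s → u ≠ (starRingAut : ℂ ≃+* ℂ) • s → u ≠ t → u ≠ (starRingAut : ℂ ≃+* ℂ) • t →
        σ • u = u)
    (heven : ∀ τ : ℂ ≃+* ℂ,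
      Even (Finset.univ.filter fun x : K i₀ →+* ℂ => x ∈ (Φ i₀).1 ∧ τ • x ∉ (Φ i₀).1).card)
    {ψ₀ : K i₁ →+* ℂ}
    (hψ₀ : ∀ σ : ℂ ≃+* ℂ, σ • ψ₀ = ψ₀ ↔ ∀ x : K i₀ →+* ℂ, σ • x ∈ (Φ i₀).1 ↔ x ∈ (Φ i₀).1) :
    CMAlgebra.cmFamilyRank Φ + Fintype.card I = (∑ i, cmTypeRank (Φ i)) + 1 ↔
      ¬ ∃ a b : ℕ, a ≠ b ∧ ∀ x : K i₀ →+* ℂ,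
        (Finset.univ.filter fun y : K i₁ →+* ℂ =>
          y ∈ (Φ i₁).1 ∧ ∃ σ : ℂ ≃+* ℂ, σ • ψ₀ = y ∧ σ⁻¹ • x ∈ (Φ i₀).1).card =
          if x ∈ (Φ i₀).1 then a else b := by
  haveI := isPretransitive_ringEquiv_complex (K := K i₀)
  haveI : Nonempty I := ⟨i₀⟩
  obtain ⟨T, hT, hTi, hT₀, hY, hmem⟩ := exists_typeMap_of_reflexEmbedding (Φ i₀) hψ₀
  have h6' : 6 ≤ Fintype.card (K i₀ →+* ℂ) := by rw [Embeddings.card]; exact h6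
  have key := ReflexSlot.typeRank_sigmaType_add_card_eq_iff_of_doubleFlip_of_typeMap (G := ℂ ≃+* ℂ)
    (Φ := fun i => (Φ i).1) (fun i => isCMTypeWith_conj (Φ i)) hI h01 h6' hflip hT hTi hT₀ hY
    (ReflexSlot.even_card_typeMap_diff_of_even_conj hT hT₀ hY heven)
  refine key.trans ?_
  simp only [hmem]

/-- **The same from the IMAGE of `ψ₀`** (`ψ₀(K_{i₁}) = traceField Φ₀`, the complex reflex field; gen 45's bridge).
[cite: Shimura1998, §8.3 Prop. 28] [cite: Gordon1999HodgeAVSurvey, 7.5–7.7 and 9.4.3] -/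
theorem isNondegenerateFamily_iff_of_doubleFlip_of_range_eq_traceField (hI : ∀ i, i = i₀ ∨ i = i₁) (h01 : i₀ ≠ i₁)
    (h6 : 6 ≤ finrank ℚ (K i₀))
    (hflip : ∀ s t : K i₀ →+* ℂ, t ≠ s → t ≠ (starRingAut : ℂ ≃+* ℂ) • s → ∃ σ : ℂ ≃+* ℂ,
      σ • s = (starRingAut : ℂ ≃+* ℂ) • s ∧ σ • t = (starRingAut : ℂ ≃+* ℂ) • t ∧
      ∀ u : K i₀ →+* ℂ, u ≠ s → u ≠ (starRingAut : ℂ ≃+* ℂ) • s → u ≠ t → u ≠ (starRingAut : ℂ ≃+* ℂ) • t →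
        σ • u = u)
    (heven : ∀ τ : ℂ ≃+* ℂ,
      Even (Finset.univ.filter fun x : K i₀ →+* ℂ => x ∈ (Φ i₀).1 ∧ τ • x ∉ (Φ i₀).1).card)
    {ψ₀ : K i₁ →+* ℂ} (hr : Set.range ψ₀ = (traceField (Φ i₀) : Set ℂ)) :
    CMAlgebra.IsNondegenerateFamily Φ ↔ IsNondegenerate (Φ i₁) ∧
      ¬ ∃ a b : ℕ, a ≠ b ∧ ∀ x : K i₀ →+* ℂ,
        (Finset.univ.filter fun y : K i₁ →+* ℂ =>
          y ∈ (Φ i₁).1 ∧ ∃ σ : ℂ ≃+* ℂ, σ • ψ₀ = y ∧ σ⁻¹ • x ∈ (Φ i₀).1).card =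
          if x ∈ (Φ i₀).1 then a else b :=
  isNondegenerateFamily_iff_of_doubleFlip_of_reflexEmbedding hI h01 h6 hflip heven
    (smul_eq_iff_forall_smul_mem_iff_of_range_eq_traceField (Φ i₀) ψ₀ hr)

end Types

/-! ### §2 Abelian varieties -/

section Varieties

variable [Nonempty I] {A : I → AbelianVariety ℂ} {ι : ∀ i, 𝓞 (K i) →+* End (A i)}
  {θ : ∀ i, K i →+* Module.End ℂ (complexBetti (A i).X 1)}

/-- **The Hodge conjecture on every `A₀^a × A₁^b`** (every `⨁_{j<N} A_{π j}`), with `B• = D•` there, for a realisation `A₀`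
of a double-flip type with (EV) (degree `≥ 6`) and a realisation `A₁` of a NONDEGENERATE type of its reflex field whose
incidence numbers are not constant-unequal — UNCONDITIONALLY. [cite: Gordon1999HodgeAVSurvey, 7.5 and 10.10] -/
theorem hodgeConjectureFor_prod_of_doubleFlip_of_reflexEmbedding (hI : ∀ i, i = i₀ ∨ i = i₁) (h01 : i₀ ≠ i₁)
    (h6 : 6 ≤ finrank ℚ (K i₀))
    (hflip : ∀ s t : K i₀ →+* ℂ, t ≠ s → t ≠ (starRingAut : ℂ ≃+* ℂ) • s → ∃ σ : ℂ ≃+* ℂ,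
      σ • s = (starRingAut : ℂ ≃+* ℂ) • s ∧ σ • t = (starRingAut : ℂ ≃+* ℂ) • t ∧
      ∀ u : K i₀ →+* ℂ, u ≠ s → u ≠ (starRingAut : ℂ ≃+* ℂ) • s → u ≠ t → u ≠ (starRingAut : ℂ ≃+* ℂ) • t →
        σ • u = u)
    (heven : ∀ τ : ℂ ≃+* ℂ,
      Even (Finset.univ.filter fun x : K i₀ →+* ℂ => x ∈ (Φ i₀).1 ∧ τ • x ∉ (Φ i₀).1).card)
    {ψ₀ : K i₁ →+* ℂ}
    (hψ₀ : ∀ σ : ℂ ≃+* ℂ, σ • ψ₀ = ψ₀ ↔ ∀ x : K i₀ →+* ℂ, σ • x ∈ (Φ i₀).1 ↔ x ∈ (Φ i₀).1)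
    (hnd : IsNondegenerate (Φ i₁))
    (hnot : ¬ ∃ a b : ℕ, a ≠ b ∧ ∀ x : K i₀ →+* ℂ,
      (Finset.univ.filter fun y : K i₁ →+* ℂ =>
        y ∈ (Φ i₁).1 ∧ ∃ σ : ℂ ≃+* ℂ, σ • ψ₀ = y ∧ σ⁻¹ • x ∈ (Φ i₀).1).card = if x ∈ (Φ i₀).1 then a else b)
    (hA : ∀ i, IsCMTypeRealisation (Φ i) (A i) (ι i) (θ i)) {N : ℕ} (π : Fin N → I) :
    HodgeConjectureFor (⨁ fun j : Fin N => A (π j)).dim (⨁ fun j : Fin N => A (π j)).X ∧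
      ∀ m : ℕ, hodgeClassSpan (⨁ fun j : Fin N => A (π j)).dim (⨁ fun j : Fin N => A (π j)).X m =
        divisorClassesSpan (⨁ fun j : Fin N => A (π j)).X (⨁ fun j : Fin N => A (π j)).dim m :=
  have h := (isNondegenerateFamily_iff_of_doubleFlip_of_reflexEmbedding hI h01 h6 hflip heven hψ₀).2 ⟨hnd, hnot⟩
  ⟨h.hodgeConjectureFor_prod hA π, fun m => h.hodgeClassSpan_prod_eq_divisorClassesSpan hA π m⟩

/-- **SIMPLE, NON-ISOGENOUS realisations (double-flip field with (EV) × reflex field): `B• = D•` on ALL products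
`A₀^a × A₁^b` IFF `Φ₁` is nondegenerate and its incidence numbers are not constant-unequal**; otherwise some product carries an
exceptional Hodge class. [cite: Gordon1999HodgeAVSurvey, 7.5 and 7.6.1] -/
theorem forall_prod_hodgeClassSpan_eq_iff_of_doubleFlip_of_reflexEmbedding (hI : ∀ i, i = i₀ ∨ i = i₁)
    (h01 : i₀ ≠ i₁) (h6 : 6 ≤ finrank ℚ (K i₀))
    (hflip : ∀ s t : K i₀ →+* ℂ, t ≠ s → t ≠ (starRingAut : ℂ ≃+* ℂ) • s → ∃ σ : ℂ ≃+* ℂ,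
      σ • s = (starRingAut : ℂ ≃+* ℂ) • s ∧ σ • t = (starRingAut : ℂ ≃+* ℂ) • t ∧
      ∀ u : K i₀ →+* ℂ, u ≠ s → u ≠ (starRingAut : ℂ ≃+* ℂ) • s → u ≠ t → u ≠ (starRingAut : ℂ ≃+* ℂ) • t →
        σ • u = u)
    (heven : ∀ τ : ℂ ≃+* ℂ,
      Even (Finset.univ.filter fun x : K i₀ →+* ℂ => x ∈ (Φ i₀).1 ∧ τ • x ∉ (Φ i₀).1).card)
    {ψ₀ : K i₁ →+* ℂ}
    (hψ₀ : ∀ σ : ℂ ≃+* ℂ, σ • ψ₀ = ψ₀ ↔ ∀ x : K i₀ →+* ℂ, σ • x ∈ (Φ i₀).1 ↔ x ∈ (Φ i₀).1)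
    (hA : ∀ i, IsCMTypeRealisation (Φ i) (A i) (ι i) (θ i)) (hs : ∀ i, (A i).IsSimple)
    (hniso : ∀ i i', i ≠ i' → ¬ AbelianVariety.IsIsogenous (A i) (A i')) :
    (∀ (N : ℕ) (π : Fin N → I) (m : ℕ),
      hodgeClassSpan (⨁ fun j : Fin N => A (π j)).dim (⨁ fun j : Fin N => A (π j)).X m =
        divisorClassesSpan (⨁ fun j : Fin N => A (π j)).X (⨁ fun j : Fin N => A (π j)).dim m) ↔
      IsNondegenerate (Φ i₁) ∧ ¬ ∃ a b : ℕ, a ≠ b ∧ ∀ x : K i₀ →+* ℂ,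
        (Finset.univ.filter fun y : K i₁ →+* ℂ =>
          y ∈ (Φ i₁).1 ∧ ∃ σ : ℂ ≃+* ℂ, σ • ψ₀ = y ∧ σ⁻¹ • x ∈ (Φ i₀).1).card =
          if x ∈ (Φ i₀).1 then a else b := by
  rw [← CMAlgebra.isNondegenerateFamily_iff_forall_prod_hodgeClassSpan_eq
    (CMAlgebra.isSeparatingFamily_of_isSimple_of_pairwise_not_isIsogenous hA hs hniso) hA]
  exact isNondegenerateFamily_iff_of_doubleFlip_of_reflexEmbedding hI h01 h6 hflip heven hψ₀

end Varieties

end Summit.HodgeConjecture.CorCM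

end
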